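import Mathlib
import Summits.Ventures.PercRepro2.HCov
import Summits.Ventures.PercRepro2.EdgeCubic
import Summits.Ventures.PercRepro2.EdgeCubicAll
import Summits.Ventures.PercRepro2.CPolarA3
import Summits.Ventures.PercRepro2.CPolarA3Marks
import Summits.Ventures.PercRepro2.PendantClusterPins
import Summits.Ventures.PercRepro2.PendantClusterBern
import Summits.Ventures.PercRepro2.CPolarA3Exists
import Summits.Ventures.PercRepro2.ClusterRootBern
import Summits.Ventures.PercRepro2.GcTransport
import Summits.Ventures.PercRepro2.EdgeReloc
import Summits.Ventures.PercRepro2.ReachRootEdge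
import Summits.Ventures.PercRepro2.CPolarSub
import Summits.Ventures.PercRepro2.CPolarSubClasses
import Summits.Ventures.PercRepro2.CPolarSubPlus
import Summits.Ventures.PercRepro2.HCovPlusDiag
import Summits.Ventures.PercRepro2.CPolarSubNP

/-!
# INTERNAL FRACTIONAL EDGES OF THE REACH ARE FREE — the crux from `HCovPlus_all` and (SUB) at the
instances with at least two fractional boundary edges (blind cell PercRepro2, p5 g16;
`proofs/P5-OEDGE.md` §22)

A fractional edge `e = {u, z}` with BOTH ends in the pinned-open reach of `a₃` changes no
connection on any configuration of positive weight (its ends are already joined through the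
weight-`1` edges): every connection event is `FreeAE` for `e` (**`freeAE_conn_internal`**), so
every pattern mass at `p` equals the mass at the closed pin and **`Gc_internal_eq`**:
`Gc p = Gc p[e↦0]`. Hence **`HCov_of_internal`**: (HCOV) at `p[e↦0]` gives (HCOV) at `p` — an
internal fractional edge is pinned for free, and the induction of CPolarSubNP.lean asks its
hypothesis only at instances with NO internal fractional reach-edge and at least TWO fractional
boundary edges (**`HCov_of_hcovPlus_all_of_subB2`**, **`HCov_all_of_cpolarA3SubB2_all`**): the open
hypothesis of the road is «`HCovPlus_all`, and (SUB) at one boundary edge of every mark-free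
non-null instance whose contracted `a₃` has degree ≥ 2 — class (α) and the contracted `o`-edges».
-/

namespace Summit.Ventures.PercRepro2

open UnionCluster CovForm CovForm.CPolarA3 PendantA3 PendantCluster CPolarA3Exists ClusterRoot
  ReachRoot EdgeReloc CPolarSub CPolarSubClasses CPolarSubPlus HCovPlusDiag CPolarSubNP RECM

namespace InternalEdge

open EdgeLine

/-! ## Connections are blind to an internal edge -/

section Conn

variable {V : Type*} {E : Type*} [Fintype E] [DecidableEq E] {R : Type*} [Field R]
  [LinearOrder R]

variable {p : E → R} {ends : E → Sym2 V} {e : E} {a₃ u z : V}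

/-- Opening an internal edge adds no connection: its ends are joined through the reach already. -/
lemma conn_of_conn_update_true (hu : u ∈ pinnedReach p ends a₃) (hz : z ∈ pinnedReach p ends a₃)
    (he : ends e = s(u, z)) {ω : Config E} (hw : weight p ω ≠ 0) {x y : V}
    (h : Conn ends (Function.update ω e true) x y) : Conn ends ω x y := by
  refine mem_of_conn_of_closed (S := {w | Conn ends ω x w}) ?_ (conn_refl ends ω x) h
  intro a ha b hab
  rw [openGraph_adj] at hab
  obtain ⟨_, e', he'o, hends⟩ := hab
  by_cases hee : e' = e
  · subst hee
    rw [he] at hends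
    have huz : Conn ends ω u z :=
      conn_trans (conn_symm (conn_of_mem_pinnedReach hw hu)) (conn_of_mem_pinnedReach hw hz)
    rcases Sym2.eq_iff.1 hends with ⟨rfl, rfl⟩ | ⟨rfl, rfl⟩
    · exact conn_trans ha huz
    · exact conn_trans ha (conn_symm huz)
  · rw [Function.update_of_ne hee] at he'o
    exact conn_trans ha (conn_of_openAdj ⟨e', he'o, hends⟩)

/-- Closing an internal edge removes no connection (the reach path avoids the fractional `e`). -/
lemma conn_update_false_of_conn (hu : u ∈ pinnedReach p ends a₃) (hz : z ∈ pinnedReach p ends a₃)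
    (he : ends e = s(u, z)) (hf1 : p e ≠ 1) {ω : Config E} (hw : weight p ω ≠ 0) {x y : V}
    (h : Conn ends ω x y) : Conn ends (Function.update ω e false) x y := by
  refine mem_of_conn_of_closed (S := {w | Conn ends (Function.update ω e false) x w}) ?_
    (conn_refl ends _ x) h
  intro a ha b hab
  rw [openGraph_adj] at hab
  obtain ⟨_, e', he'o, hends⟩ := hab
  have hle : pinnedConfig p ≤ Function.update ω e false :=
    EdgeReloc.pinnedConfig_le_update_false (q := p) (fun _ _ => rfl) hf1 hw
  by_cases hee : e' = e
  · subst hee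
    rw [he] at hends
    have huz : Conn ends (Function.update ω e' false) u z :=
      conn_trans (conn_symm (conn_mono hle hu)) (conn_mono hle hz)
    rcases Sym2.eq_iff.1 hends with ⟨rfl, rfl⟩ | ⟨rfl, rfl⟩
    · exact conn_trans ha huz
    · exact conn_trans ha (conn_symm huz)
  · exact conn_trans ha (conn_of_openAdj ⟨e', by rw [Function.update_of_ne hee]; exact he'o, hends⟩)

/-- **Connections are blind to an internal fractional edge** on every configuration of positive
weight: `FreeAE p e {x ↔ y}`. -/
lemma freeAE_conn_internal (hu : u ∈ pinnedReach p ends a₃) (hz : z ∈ pinnedReach p ends a₃)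
    (he : ends e = s(u, z)) (hf1 : p e ≠ 1) (x y : V) : FreeAE p e (connEvent ends x y) := by
  intro ω hw c
  simp only [mem_connEvent]
  cases c
  · exact ⟨fun h => conn_mono (update_false_le ω e) h, conn_update_false_of_conn hu hz he hf1 hw⟩
  · exact ⟨conn_of_conn_update_true hu hz he hw, fun h => conn_mono (le_update_true ω e) h⟩

end Conn

/-! ## The masses at the closed pin are the masses at `p` -/

section Masses

variable {V : Type*} {E : Type*} [Fintype E] [DecidableEq E] {R : Type*} [Field R]
  [LinearOrder R]

variable {p : E → R} {ends : E → Sym2 V} {e : E} {a₃ u z : V}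

omit [LinearOrder R] in
/-- Every event built from connections is blind to `e`; its mass at the closed pin is its mass at `p`.
Stated for the membership form used by `prob_congr_of_weight`. -/
lemma prob_update_zero_eq_of_conn {X : Set (Config E)}
    (hX : ∀ ω, weight p ω ≠ 0 → (Function.update ω e false ∈ X ↔ ω ∈ X)) :
    prob (Function.update p e 0) X = prob p X := by
  rw [prob_update_zero_eq_preimage]
  exact prob_congr_of_weight p _ _ fun ω hw => by
    simp only [Set.mem_preimage]
    exact hX ω hw

omit [LinearOrder R] in
/-- The shape of a connection-defined event, closed under the closed pin, for `simp`. -/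
lemma mem_update_iff_conn (hc : ∀ x y : V, FreeAE p e (connEvent ends x y)) {ω : Config E}
    (hw : weight p ω ≠ 0) (x y : V) :
    Conn ends (Function.update ω e false) x y ↔ Conn ends ω x y := hc x y ω hw false

variable (hu : u ∈ pinnedReach p ends a₃) (hz : z ∈ pinnedReach p ends a₃) (he : ends e = s(u, z))
  (hf1 : p e ≠ 1)

include hu hz he hf1

/-- `P(Q ∩ {x ↔ y} ∩ {x′ ↔ y′})` at the closed pin. -/
lemma prob_Q_cc_zero (a₁ a₂ x y x' y' : V) :
    prob (Function.update p e 0) (avoidAll ends a₂ {a₁} ∩ (connEvent ends x y ∩ connEvent ends x' y')) =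
      prob p (avoidAll ends a₂ {a₁} ∩ (connEvent ends x y ∩ connEvent ends x' y')) :=
  prob_update_zero_eq_of_conn fun ω hw => by
    simp only [Set.mem_inter_iff, mem_connEvent, mem_avoidAll, Finset.mem_singleton, forall_eq,
      mem_update_iff_conn (freeAE_conn_internal hu hz he hf1) hw]

/-- `P(Q ∩ {x ↔ y})` at the closed pin. -/
lemma prob_Q_c_zero (a₁ a₂ x y : V) :
    prob (Function.update p e 0) (avoidAll ends a₂ {a₁} ∩ connEvent ends x y) =
      prob p (avoidAll ends a₂ {a₁} ∩ connEvent ends x y) :=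
  prob_update_zero_eq_of_conn fun ω hw => by
    simp only [Set.mem_inter_iff, mem_connEvent, mem_avoidAll, Finset.mem_singleton, forall_eq,
      mem_update_iff_conn (freeAE_conn_internal hu hz he hf1) hw]

/-- `P(Q)` at the closed pin. -/
lemma prob_Q_zero (a₁ a₂ : V) :
    prob (Function.update p e 0) (avoidAll ends a₂ {a₁}) = prob p (avoidAll ends a₂ {a₁}) :=
  prob_update_zero_eq_of_conn fun ω hw => by
    simp only [mem_avoidAll, Finset.mem_singleton, forall_eq,
      mem_update_iff_conn (freeAE_conn_internal hu hz he hf1) hw]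

/-- `P(T ∩ {x ↔ y})` at the closed pin. -/
lemma prob_T_c_zero (a₁ a₂ a₃' x y : V) :
    prob (Function.update p e 0) (TEvent ends a₁ a₂ a₃' ∩ connEvent ends x y) =
      prob p (TEvent ends a₁ a₂ a₃' ∩ connEvent ends x y) :=
  prob_update_zero_eq_of_conn fun ω hw => by
    simp only [Set.mem_inter_iff, mem_connEvent, TEvent, Set.mem_compl_iff,
      mem_update_iff_conn (freeAE_conn_internal hu hz he hf1) hw]

/-- `P(T ∩ {x ↔ y} ∩ {x′ ↔ y′})` at the closed pin. -/
lemma prob_T_cc_zero (a₁ a₂ a₃' x y x' y' : V) :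
    prob (Function.update p e 0) (TEvent ends a₁ a₂ a₃' ∩ (connEvent ends x y ∩ connEvent ends x' y')) =
      prob p (TEvent ends a₁ a₂ a₃' ∩ (connEvent ends x y ∩ connEvent ends x' y')) :=
  prob_update_zero_eq_of_conn fun ω hw => by
    simp only [Set.mem_inter_iff, mem_connEvent, TEvent, Set.mem_compl_iff,
      mem_update_iff_conn (freeAE_conn_internal hu hz he hf1) hw]

/-- `P(T)` at the closed pin. -/
lemma prob_T_zero (a₁ a₂ a₃' : V) :
    prob (Function.update p e 0) (TEvent ends a₁ a₂ a₃') = prob p (TEvent ends a₁ a₂ a₃') :=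
  prob_update_zero_eq_of_conn fun ω hw => by
    simp only [TEvent, Set.mem_inter_iff, mem_connEvent, Set.mem_compl_iff,
      mem_update_iff_conn (freeAE_conn_internal hu hz he hf1) hw]

/-- `P(PD ∩ {x ↔ y})` at the closed pin. -/
lemma prob_PD_c_zero (a₁ a₂ a₃' x y : V) :
    prob (Function.update p e 0) (PDEvent ends a₁ a₂ a₃' ∩ connEvent ends x y) =
      prob p (PDEvent ends a₁ a₂ a₃' ∩ connEvent ends x y) :=
  prob_update_zero_eq_of_conn fun ω hw => by
    simp only [Set.mem_inter_iff, mem_connEvent, PDEvent, Dtilde, Set.mem_compl_iff, mem_inU,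
      mem_update_iff_conn (freeAE_conn_internal hu hz he hf1) hw]

/-- `P(PD ∩ {x ↔ y} ∩ {x′ ↔ y′})` at the closed pin. -/
lemma prob_PD_cc_zero (a₁ a₂ a₃' x y x' y' : V) :
    prob (Function.update p e 0) (PDEvent ends a₁ a₂ a₃' ∩ (connEvent ends x y ∩ connEvent ends x' y')) =
      prob p (PDEvent ends a₁ a₂ a₃' ∩ (connEvent ends x y ∩ connEvent ends x' y')) :=
  prob_update_zero_eq_of_conn fun ω hw => by
    simp only [Set.mem_inter_iff, mem_connEvent, PDEvent, Dtilde, Set.mem_compl_iff, mem_inU,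
      mem_update_iff_conn (freeAE_conn_internal hu hz he hf1) hw]

/-- `P(PD)` at the closed pin. -/
lemma prob_PD_zero (a₁ a₂ a₃' : V) :
    prob (Function.update p e 0) (PDEvent ends a₁ a₂ a₃') = prob p (PDEvent ends a₁ a₂ a₃') :=
  prob_update_zero_eq_of_conn fun ω hw => by
    simp only [PDEvent, Dtilde, Set.mem_inter_iff, mem_connEvent, Set.mem_compl_iff, mem_inU,
      mem_update_iff_conn (freeAE_conn_internal hu hz he hf1) hw]

/-- `P(x ↔ y)` at the closed pin. -/
lemma prob_c_zero (x y : V) :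
    prob (Function.update p e 0) (connEvent ends x y) = prob p (connEvent ends x y) :=
  prob_update_zero_eq_of_conn fun ω hw => by
    simp only [mem_connEvent, mem_update_iff_conn (freeAE_conn_internal hu hz he hf1) hw]

/-- **`Gc` does not see an internal fractional edge**: `Gc p = Gc p[e↦0]`. -/
theorem Gc_internal_eq (o a₁ a₂ b : V) (a₃' : V) :
    Gc p ends o a₁ a₂ a₃' b = Gc (Function.update p e 0) ends o a₁ a₂ a₃' b := by
  unfold Gc DEF EQbo EQb3 EQb3o EQo EQ3 EQ3o PDb PDbo Do gap
  simp only [prob_Q_cc_zero hu hz he hf1, prob_Q_c_zero hu hz he hf1, prob_Q_zero hu hz he hf1,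
    prob_T_c_zero hu hz he hf1, prob_T_cc_zero hu hz he hf1, prob_T_zero hu hz he hf1,
    prob_PD_c_zero hu hz he hf1, prob_PD_cc_zero hu hz he hf1, prob_PD_zero hu hz he hf1,
    prob_c_zero hu hz he hf1]

end Masses

/-! ## (HCOV) across an internal edge, and the induction -/

section Induction

variable {V E : Type} [Fintype V] [DecidableEq V] [Fintype E] [DecidableEq E]
  {R : Type*} [Field R] [LinearOrder R] [IsStrictOrderedRing R]

omit [Fintype V] [DecidableEq V] [IsStrictOrderedRing R] in
/-- **(HCOV) at the closed pin of an internal fractional edge gives (HCOV) at `p`.** -/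
theorem HCov_of_internal {p : E → R} {ends : E → Sym2 V} {e : E} {a₃ u z : V}
    (hu : u ∈ pinnedReach p ends a₃) (hz : z ∈ pinnedReach p ends a₃) (he : ends e = s(u, z))
    (hf1 : p e ≠ 1) (o a₁ a₂ b : V) (h₀ : HCov (Function.update p e 0) ends o a₁ a₂ a₃ b) :
    HCov p ends o a₁ a₂ a₃ b := by
  unfold HCov at h₀ ⊢
  rw [Gc_internal_eq hu hz he hf1]
  exact h₀

/-- An internal fractional edge of the reach of `a₃`: both ends in the reach. -/
def IsInternalEdge (p : E → R) (ends : E → Sym2 V) (a₃ : V) (e : E) : Prop :=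
  ∃ u z, ends e = s(u, z) ∧ u ∈ pinnedReach p ends a₃ ∧ z ∈ pinnedReach p ends a₃

/-- **(HCOV) from `HCovPlus_all` and a good edge at every mark-free non-null instance with no
internal fractional reach-edge and no pendant edge** (hence at least two fractional boundary edges). -/
theorem HCov_of_hcovPlus_all_of_subB2 (hall : HCovPlus_all R) (ends : E → Sym2 V) (o a₁ a₂ a₃ b : V)
    (h1 : a₁ ≠ a₂) (h2 : a₁ ≠ a₃) (h3 : a₂ ≠ a₃) (h4 : o ≠ a₁) (h5 : o ≠ a₂) (h6 : o ≠ a₃)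
    (h7 : o ≠ b) (h8 : b ≠ a₁) (h9 : b ≠ a₂) (h10 : b ≠ a₃)
    (hB : ∀ q : E → R, IsProbVec q → MarkFree q ends o a₁ a₂ a₃ b →
      prob q (avoidAll ends a₂ {a₁}) ≠ 0 → (∃ e ∈ fracEdges q, TouchesReach q ends a₃ e) →
      (¬ ∃ e ∈ fracEdges q, IsInternalEdge q ends a₃ e) → (¬ ∃ f, IsPendantEdge q ends a₃ f) →
      ∃ e ∈ fracEdges q, TouchesReach q ends a₃ e ∧ GoodEdgeSub q ends o a₁ a₂ a₃ b e)
    (p : E → R) (hp : IsProbVec p) : HCov p ends o a₁ a₂ a₃ b := by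
  generalize hn : (fracEdges p).card = n
  induction n using Nat.strong_induction_on generalizing p with
  | _ n ih =>
    by_cases hm : a₁ ∈ pinnedReach p ends a₃ ∨ a₂ ∈ pinnedReach p ends a₃ ∨
        o ∈ pinnedReach p ends a₃ ∨ b ∈ pinnedReach p ends a₃
    · exact HCov_of_mark_mem_pinnedReach hp hm
    · have hfree : MarkFree p ends o a₁ a₂ a₃ b := by
        simp only [not_or] at hm
        exact ⟨hm.1, hm.2.1, hm.2.2.1, hm.2.2.2⟩
      by_cases hQ : prob p (avoidAll ends a₂ {a₁}) = 0
      · exact HCov_of_Q_eq_zero hp hQ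
      by_cases hint : ∃ e ∈ fracEdges p, IsInternalEdge p ends a₃ e
      · -- an internal fractional edge: pin it closed for free
        obtain ⟨e, he, u, z, hends, hu, hz⟩ := hint
        have hfe : p e ≠ 0 ∧ p e ≠ 1 := by simpa [fracEdges] using he
        have hlt : ((fracEdges p).erase e).card < n := by
          rw [← hn]; exact Finset.card_erase_lt_of_mem he
        have hp₀ : IsProbVec (Function.update p e 0) := hp.update e le_rfl zero_le_one
        exact HCov_of_internal hu hz hends hfe.2 o a₁ a₂ b
          (ih _ hlt (Function.update p e 0) hp₀ (by rw [fracEdges_update p e 0 (Or.inl rfl)]))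
      by_cases h : ∃ e ∈ fracEdges p, TouchesReach p ends a₃ e
      · have hgoodex : ∃ e ∈ fracEdges p, TouchesReach p ends a₃ e ∧
            GoodEdgeSub p ends o a₁ a₂ a₃ b e := by
          by_cases hpend : ∃ f, IsPendantEdge p ends a₃ f
          · obtain ⟨f, hf⟩ := hpend
            obtain ⟨e, he, ht⟩ := h
            have hef : e = f := hf.1 e he ht
            subst hef
            have hfe : p e ≠ 0 ∧ p e ≠ 1 := by simpa [fracEdges] using he
            have hlt : ((fracEdges p).erase e).card < n := by
              rw [← hn]; exact Finset.card_erase_lt_of_mem he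
            have hp₁ : IsProbVec (Function.update p e 1) := hp.update e zero_le_one le_rfl
            have hopen : HCov (Function.update p e 1) ends o a₁ a₂ a₃ b :=
              ih _ hlt (Function.update p e 1) hp₁ (by rw [fracEdges_update p e 1 (Or.inr rfl)])
            exact ⟨e, he, ht, goodEdgeSub_of_pendant hall hp h1 h2 h3 h4 h5 h6 h7 h8 h9 h10 hfree hf
              hfe.2 hQ hopen⟩
          · exact hB p hp hfree hQ h hint hpend
        obtain ⟨e, he, _, hgood⟩ := hgoodex
        have hlt : ((fracEdges p).erase e).card < n := by
          rw [← hn]; exact Finset.card_erase_lt_of_mem he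
        have hp₀ : IsProbVec (Function.update p e 0) := hp.update e le_rfl zero_le_one
        have hp₁ : IsProbVec (Function.update p e 1) := hp.update e zero_le_one le_rfl
        have h₀ : HCov (Function.update p e 0) ends o a₁ a₂ a₃ b :=
          ih _ hlt (Function.update p e 0) hp₀ (by rw [fracEdges_update p e 0 (Or.inl rfl)])
        have h₁ : HCov (Function.update p e 1) ends o a₁ a₂ a₃ b :=
          ih _ hlt (Function.update p e 1) hp₁ (by rw [fracEdges_update p e 1 (Or.inr rfl)])
        have hfe : p e ≠ 0 ∧ p e ≠ 1 := by simpa [fracEdges] using he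
        rcases hgood with (hr | hpa | ⟨hB1, hB2⟩) | ⟨hpos, hs1, hs2⟩
        · obtain ⟨hB1, hB2⟩ := bern_nonneg_of_isReachRootEdge p hp ends o a₁ a₂ a₃ b e hr hfe.2 h₀
          exact HCov_of_update_zero_of_bern p hp ends o a₁ a₂ a₃ b e h₀ h₁ hB1 hB2
        · obtain ⟨hK, z, u, hends, hz, hu, hD, hcov⟩ := hpa
          exact HCov_cluster_of_cov_nonneg p hp hK hends hz hu hfe.2 hfree.1 hfree.2.1
            hfree.2.2.1 hfree.2.2.2 hD h₀ h₁ hcov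
        · exact HCov_of_update_zero_of_bern p hp ends o a₁ a₂ a₃ b e h₀ h₁ hB1 hB2
        · exact HCov_of_update_zero_of_sub p hp ends o a₁ a₂ a₃ b e hpos h₀ h₁ hs1 hs2
      · simp only [not_exists, not_and] at h
        exact HCov_of_reach_pinned p hp ends o a₁ a₂ a₃ b h

end Induction

section Closure

variable (R : Type*) [Field R] [LinearOrder R] [IsStrictOrderedRing R]

/-- **(SUB) at one `a₃`-edge of every mark-free, non-null instance with no internal fractional
reach-edge and no pendant edge** — i.e. whose contracted `a₃` has at least two fractional boundary
edges (class (α) and the contracted `o`-edges). -/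
def CPolarA3SubB2_all : Prop :=
  ∀ (V E : Type) [Fintype V] [DecidableEq V] [Fintype E] [DecidableEq E]
    (ends : E → Sym2 V) (p : E → R), IsProbVec p →
    ∀ o a₁ a₂ a₃ b : V, a₁ ≠ a₂ → a₁ ≠ a₃ → a₂ ≠ a₃ → o ≠ a₁ → o ≠ a₂ → o ≠ a₃ → o ≠ b →
      b ≠ a₁ → b ≠ a₂ → b ≠ a₃ → MarkFree p ends o a₁ a₂ a₃ b →
      prob p (avoidAll ends a₂ {a₁}) ≠ 0 → (∃ e ∈ fracEdges p, TouchesReach p ends a₃ e) →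
      (¬ ∃ e ∈ fracEdges p, IsInternalEdge p ends a₃ e) → (¬ ∃ f, IsPendantEdge p ends a₃ f) →
      ∃ e ∈ fracEdges p, TouchesReach p ends a₃ e ∧ GoodEdgeSub p ends o a₁ a₂ a₃ b e

omit [IsStrictOrderedRing R] in
/-- `CPolarA3SubB2_all` is weaker than `CPolarA3SubNP_all`. -/
theorem cpolarA3SubB2_all_of_cpolarA3SubNP_all (h : CPolarA3SubNP_all R) :
    CPolarA3SubB2_all R :=
  fun V E _ _ _ _ ends p hp o a₁ a₂ a₃ b h1 h2 h3 h4 h5 h6 h7 h8 h9 h10 hfree hQ hex _ hnp =>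
    h V E ends p hp o a₁ a₂ a₃ b h1 h2 h3 h4 h5 h6 h7 h8 h9 h10 hfree hQ hex hnp

/-- **The crux from `HCovPlus_all` and (SUB) at the instances with ≥ 2 fractional boundary edges.** -/
theorem HCov_all_of_cpolarA3SubB2_all (hall : HCovPlus_all R) (h : CPolarA3SubB2_all R) :
    HCov_all R := by
  intro V E _ _ _ _ ends p hp o a₁ a₂ a₃ b h1 h2 h3 h4 h5 h6 h7 h8 h9 h10
  exact HCov_of_hcovPlus_all_of_subB2 hall ends o a₁ a₂ a₃ b h1 h2 h3 h4 h5 h6 h7 h8 h9 h10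
    (fun q hq hfree hQ hex hint hnp =>
      h V E ends q hq o a₁ a₂ a₃ b h1 h2 h3 h4 h5 h6 h7 h8 h9 h10 hfree hQ hex hint hnp) p hp

end Closure

end InternalEdge

end Summit.Ventures.PercRepro2
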